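import Literature.AlgebraicGeometry.Modules.CechObjects
import Literature.AlgebraicGeometry.Modules.LocalExactness
import Literature.Algebra.Homology.IteratedExtClass
import Mathlib.AlgebraicTopology.AlternatingFaceMapComplex
import HarnessLib

/-!
# The Čech resolution `0 → M → Č⁰(𝓤, M) → Č¹(𝓤, M) → ⋯` of an `𝒪_X`-module

For a scheme `X`, a family of opens `𝓤 = (U_i)_{i ∈ ι}` and an `𝒪_X`-module `M`, the Čech sheaves
`Čⁿ(𝓤, M)` (`CechObjects.lean`) form a cosimplicial `𝒪_X`-module (`Cech.cosimplicial`); the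
**sheaf Čech complex** `Č•(𝓤, M)` (`Cech.complex`) has the alternating sums of the coface maps as
differentials (`Cech.d`, `(ds)_α = Σ_k (-1)^k s_{α ∘ δ_k}|_{U_α}`, `Cech.d_app_apply`; `d ∘ d = 0`
from Mathlib's alternating coface complex), and is augmented by `ε : M → Č⁰(𝓤, M)`,
`x ↦ (x|_{U_i})_i` (`Cech.augment`). When `𝓤` COVERS `X` the augmented complex is EXACT —
Hartshorne III Lemma 4.2 ("`0 → ℱ → 𝒞⁰ → 𝒞¹ → ⋯` is a resolution of `ℱ`"), Godement II
Thm. 5.2.1: over an open `V ⊆ U_a` the complex of sections has the contracting homotopy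
`(hs)_α = s_{(a, α)}` (`Cech.homotopy`, `Cech.d_homotopy_add_homotopy_d`), and exactness of sheaves
is local (`Modules.exact_of_locally_exact`). The result is packaged as an
`ExactAugmentation (Cech.complex U M) M` (`Cech.exactAugmentation`), the input of the iterated
connecting classes `θ` of `Literature/Algebra/Homology/IteratedExtClass.lean`.

## References

* R. Hartshorne, *Algebraic Geometry*, GTM 52 (1977), III Lemma 4.2. [Hartshorne1977]
* R. Godement, *Topologie algébrique et théorie des faisceaux* (1958), II Thm. 5.2.1.
-/

noncomputable section

universe u

open CategoryTheory AlgebraicGeometry Opposite TopologicalSpace Limits AlgebraicTopology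
open scoped Simplicial

namespace Literature.AlgebraicGeometry.Modules

namespace Cech

variable {X : Scheme.{u}} {ι : Type u} (U : ι → X.Opens) (M : X.Modules)

/-! ### The cosimplicial Čech sheaf, the differential, the complex -/

/-- **The cosimplicial `𝒪_X`-module `[n] ↦ Čⁿ(𝓤, M)`.** [folklore] -/
def cosimplicial : CosimplicialObject X.Modules where
  obj Δ := obj U Δ.len M
  map θ := structMap U _ M ⇑θ.toOrderHom
  map_id Δ := by
    rw [SimplexCategory.id_toOrderHom]
    exact structMap_id U _ M
  map_comp {Δ Δ' Δ''} θ θ' := by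
    rw [SimplexCategory.comp_toOrderHom, OrderHom.comp_coe]
    exact structMap_comp U Δ''.len M ⇑θ.toOrderHom ⇑θ'.toOrderHom

/-- **The Čech differential** `d : Čⁿ(𝓤, M) → Čⁿ⁺¹(𝓤, M)`, the alternating sum of the coface maps
`δ_k^* : s ↦ (s_{α ∘ δ_k}|_{U_α})_α`. [cite: Hartshorne1977, III.4 (definition of d)] -/
def d (n : ℕ) : obj U n M ⟶ obj U (n + 1) M :=
  ∑ k : Fin (n + 2), (-1 : ℤ) ^ (k : ℕ) • structMap U (n + 1) M (Fin.succAbove k)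

/-- The Čech differential is the differential of the alternating coface complex of
`cosimplicial` (definitionally), hence `d ∘ d = 0`. [folklore] -/
lemma d_comp_d (n : ℕ) : d U M n ≫ d U M (n + 1) = 0 :=
  AlternatingCofaceMapComplex.d_squared (cosimplicial U M) n

/-- **The sheaf Čech complex `Č•(𝓤, M)`.** [cite: Hartshorne1977, III.4 before Lemma 4.2] -/
def complex : CochainComplex X.Modules ℕ := CochainComplex.of (fun n => obj U n M) (d U M) (d_comp_d U M)

/-- The terms of the Čech complex are the Čech sheaves (definitional). [folklore] -/
lemma complex_X (n : ℕ) : (complex U M).X n = obj U n M := rfl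

/-- The differentials of the Čech complex are `Cech.d`. [folklore] -/
@[simp] lemma complex_d (n : ℕ) : (complex U M).d n (n + 1) = d U M n := by
  exact CochainComplex.of_d (fun n => obj U n M) (d U M) n

/-- **The Čech differential on sections**: `(ds)_α = Σ_k (-1)^k s_{α ∘ δ_k}|_{U_α}`.
[cite: Hartshorne1977, III.4 (definition of d)] -/
lemma d_app_apply {n : ℕ} (V : X.Opens) (s : Γ(obj U n M, V)) (α : Fin (n + 2) → ι) :
    ((d U M n).app V s : Sections U (n + 1) M V) α =
      ∑ k : Fin (n + 2), (-1 : ℤ) ^ (k : ℕ) •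
        res M (inf_le_inf_left V (face_le_face_comp U α (Fin.succAbove k)))
          ((s : Sections U n M V) (α ∘ Fin.succAbove k)) := by
  rw [d, sum_app_apply]
  refine Finset.sum_congr rfl fun k _ => ?_
  rw [zsmul_app_apply]
  rfl

/-- The differential of the Čech complex on plain cochains (the sectionwise formula, as a
function). [folklore] -/
def dSections (n : ℕ) (V : X.Opens) (s : Sections U n M V) : Sections U (n + 1) M V :=
  fun α => ∑ k : Fin (n + 2), (-1 : ℤ) ^ (k : ℕ) •
    res M (inf_le_inf_left V (face_le_face_comp U α (Fin.succAbove k))) (s (α ∘ Fin.succAbove k))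

/-- The differential is `dSections` on sections. [folklore] -/
lemma d_app_eq_dSections {n : ℕ} (V : X.Opens) (s : Γ(obj U n M, V)) :
    ((d U M n).app V s : Sections U (n + 1) M V) = dSections U M n V s :=
  funext fun α => d_app_apply U M V s α

/-- The degree-`0` differential: `(ds)_{(i,j)} = s_{(j)}| - s_{(i)}|`. [folklore] -/
lemma dSections_zero_apply (V : X.Opens) (s : Sections U 0 M V) (α : Fin (0 + 1 + 1) → ι) :
    dSections U M 0 V s α =
      res M (inf_le_inf_left V (face_le_face_comp U α (Fin.succAbove 0))) (s (α ∘ Fin.succAbove 0)) -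
        res M (inf_le_inf_left V (face_le_face_comp U α (Fin.succAbove 1)))
          (s (α ∘ Fin.succAbove 1)) := by
  rw [dSections, Fin.sum_univ_succ, Fin.sum_univ_one, Fin.val_zero, pow_zero, one_smul, Fin.val_succ,
    Fin.val_zero, pow_succ, pow_zero, one_mul, neg_one_smul, Fin.succ_zero_eq_one, sub_eq_add_neg]

/-! ### The augmentation -/

/-- **The augmentation `ε : M → Č⁰(𝓤, M)`**, `x ↦ (x|_{V ⊓ U_i})_i`. [folklore] -/
def augment : M ⟶ obj U 0 M :=
  homMk (fun V x _ => res M inf_le_left x)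
    (fun _ _ _ => funext fun _ => map_add _ _ _)
    (fun _ _ _ => funext fun _ => res_smul _ _ _)
    (fun _ _ i x => funext fun _ => by
      change res M _ (res M i.le x) = res M _ (res M _ x)
      rw [res_res, res_res])

/-- Components of the augmentation. [folklore] -/
@[simp] lemma augment_app_apply (V : X.Opens) (x : Γ(M, V)) (α : Fin 1 → ι) :
    ((augment U M).app V x : Sections U 0 M V) α = res M inf_le_left x := rfl

/-- `ε ≫ d⁰ = 0`: `(d ε x)_{(a,b)} = x|_{U_b}| - x|_{U_a}| = 0`. [folklore] -/
lemma augment_d : augment U M ≫ d U M 0 = 0 := by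
  refine hom_ext_to fun V x α => ?_
  rw [Scheme.Modules.Hom.comp_app, CategoryTheory.comp_apply, d_app_eq_dSections,
    dSections_zero_apply, augment_app_apply, augment_app_apply, res_res, res_res, sub_self,
    Scheme.Modules.Hom.zero_app]
  rfl

/-! ### The contracting homotopy over an open contained in a member of the family -/

section Homotopy

variable {U M}

/-- Restricting the `γ`-component of a cochain to the `β`-face, for `γ = β`, returns the
`β`-component. [folklore] -/
lemma res_apply_of_eq {n : ℕ} {V : X.Opens} (s : Sections U n M V) {β γ : Fin (n + 1) → ι}
    (e : γ = β) (h : V ⊓ face U β ≤ V ⊓ face U γ) : res M h (s γ) = s β := by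
  subst e; exact res_self _ _

/-- Restrictions of propositionally equal components of a cochain to a common open agree.
[folklore] -/
lemma res_apply_congr {n : ℕ} {V W : X.Opens} (s : Sections U n M V) {β γ : Fin (n + 1) → ι}
    (e : γ = β) (h : W ≤ V ⊓ face U γ) (h' : W ≤ V ⊓ face U β) : res M h (s γ) = res M h' (s β) := by
  subst e; rfl

variable {a : ι} {V : X.Opens} (hV : V ≤ U a)

include hV in
/-- Over `V ⊆ U_a`: `V ⊓ U_α ≤ V ⊓ U_{(a, α)}`. [folklore] -/
lemma inf_face_le_inf_face_cons {n : ℕ} (α : Fin (n + 1) → ι) :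
    V ⊓ face U α ≤ V ⊓ face U (Fin.cons a α : Fin (n + 2) → ι) :=
  le_inf inf_le_left (le_iInf fun k => Fin.cases (by rw [Fin.cons_zero]; exact inf_le_left.trans hV)
    (fun j => by rw [Fin.cons_succ]; exact inf_le_right.trans (face_le U α j)) k)

/-- **The contracting homotopy** `h : Čⁿ⁺¹(V) → Čⁿ(V)` over `V ⊆ U_a`: `(hs)_α = s_{(a, α)}` (read in
`Γ(M, V ⊓ U_α) = Γ(M, V ⊓ U_{(a,α)})`). [cite: Hartshorne1977, III Lemma 4.2 (proof)] -/
def homotopy (n : ℕ) (s : Sections U (n + 1) M V) : Sections U n M V :=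
  fun α => res M (inf_face_le_inf_face_cons hV α) (s (Fin.cons a α))

/-- Components of the homotopy. [folklore] -/
@[simp] lemma homotopy_apply (n : ℕ) (s : Sections U (n + 1) M V) (α : Fin (n + 1) → ι) :
    homotopy hV n s α = res M (inf_face_le_inf_face_cons hV α) (s (Fin.cons a α)) := rfl

/-- The homotopy kills `0`. [folklore] -/
@[simp] lemma homotopy_zero (n : ℕ) : homotopy hV n (0 : Sections U (n + 1) M V) = 0 :=
  funext fun _ => map_zero _

/-- `(a, β) ∘ δ₀ = β`. [folklore] -/
lemma cons_comp_succAbove_zero {n : ℕ} (β : Fin (n + 1) → ι) :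
    (Fin.cons a β : Fin (n + 2) → ι) ∘ Fin.succAbove 0 = β := by
  funext j; simp

/-- `(a, β) ∘ δ_{l+1} = (a, β ∘ δ_l)`. [folklore] -/
lemma cons_comp_succAbove_succ {n : ℕ} (β : Fin (n + 2) → ι) (l : Fin (n + 2)) :
    (Fin.cons a β : Fin (n + 3) → ι) ∘ Fin.succAbove l.succ =
      (Fin.cons a (β ∘ Fin.succAbove l) : Fin (n + 2) → ι) := by
  funext j
  refine Fin.cases ?_ (fun i => ?_) j
  · simp [Fin.succAbove_ne_zero_zero (Fin.succ_ne_zero l)]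
  · simp [Fin.succ_succAbove_succ]

/-- **The homotopy identity** `d(hs) + h(ds) = s` on `(n+1)`-cochains over `V ⊆ U_a`.
[cite: Hartshorne1977, III Lemma 4.2 (proof)] -/
theorem d_homotopy_add_homotopy_d (n : ℕ) (s : Sections U (n + 1) M V) :
    dSections U M n V (homotopy hV n s) + homotopy hV (n + 1) (dSections U M (n + 1) V s) = s := by
  funext β
  have hAl : ∀ l : Fin (n + 2), V ⊓ face U β ≤ V ⊓ face U (Fin.cons a (β ∘ Fin.succAbove l) :
      Fin (n + 2) → ι) := fun l =>
    (inf_le_inf_left V (face_le_face_comp U β (Fin.succAbove l))).trans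
      (inf_face_le_inf_face_cons hV (β ∘ Fin.succAbove l))
  have hBl : ∀ l : Fin (n + 3), V ⊓ face U β ≤
      V ⊓ face U ((Fin.cons a β : Fin (n + 3) → ι) ∘ Fin.succAbove l) := fun l =>
    (inf_face_le_inf_face_cons hV β).trans
      (inf_le_inf_left V (face_le_face_comp U (Fin.cons a β) (Fin.succAbove l)))
  have hA : dSections U M n V (homotopy hV n s) β = ∑ l : Fin (n + 2), (-1 : ℤ) ^ (l : ℕ) •
      res M (hAl l) (s (Fin.cons a (β ∘ Fin.succAbove l))) := by
    simp only [dSections, homotopy_apply, res_res]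
  have hB : homotopy hV (n + 1) (dSections U M (n + 1) V s) β =
      s β + ∑ l : Fin (n + 2), (-1 : ℤ) ^ ((l : ℕ) + 1) •
        res M (hBl l.succ) (s ((Fin.cons a β : Fin (n + 3) → ι) ∘ Fin.succAbove l.succ)) := by
    rw [homotopy_apply]
    simp only [dSections, map_sum, map_zsmul, res_res]
    rw [Fin.sum_univ_succ, Fin.val_zero, pow_zero, one_smul,
      res_apply_of_eq s (cons_comp_succAbove_zero β) (hBl 0)]
    simp only [Fin.val_succ]
  rw [add_apply, hA, hB, add_left_comm, ← Finset.sum_add_distrib, add_eq_left]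
  refine Finset.sum_eq_zero fun l _ => ?_
  rw [pow_succ, mul_neg_one, neg_smul,
    res_apply_congr s (cons_comp_succAbove_succ β l) (hBl l.succ) (hAl l), add_neg_cancel]

include hV in
/-- In degree `0`: a cochain `s` over `V ⊆ U_a` with `ds = 0` is the augmentation of `s_{(a)}`.
[cite: Hartshorne1977, III Lemma 4.2 (proof)] -/
theorem eq_augment_of_d_eq_zero (s : Sections U 0 M V) (hs : dSections U M 0 V s = 0) :
    ∃ x : Γ(M, V), ∀ β, res M (inf_le_left : V ⊓ face U β ≤ V) x = s β := by
  have hVa : V ≤ V ⊓ face U (fun _ : Fin 1 => a) :=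
    le_inf le_rfl (hV.trans (le_face_zero U (fun _ => a)))
  refine ⟨res M hVa (s fun _ => a), fun β => ?_⟩
  have h := congrFun hs (Fin.cons a β)
  rw [dSections_zero_apply, zero_apply, sub_eq_zero] at h
  -- `h : s_{(β 0)}| = s_{(a)}|` over `V ⊓ U_{(a, β)}`; restrict to `V ⊓ U_β`
  have h' := congrArg (res M (inf_face_le_inf_face_cons hV β)) h
  rw [res_res, res_res] at h'
  have ha : (Fin.cons a β : Fin 2 → ι) ∘ Fin.succAbove 1 = fun _ => a := by
    funext j; rw [Fin.eq_zero j]; rfl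
  rw [res_apply_of_eq s (cons_comp_succAbove_zero β),
    res_apply_congr s ha _ (hVa.trans' inf_le_left)] at h'
  rw [res_res, ← h']

end Homotopy

/-! ### Exactness of the augmented Čech complex for a cover -/

variable (hU : iSup U = ⊤)

/-- A morphism of `𝒪_X`-modules which is injective on all sections is a monomorphism. [folklore] -/
lemma mono_of_injective_app {A B : X.Modules} (f : A ⟶ B)
    (h : ∀ V, Function.Injective (f.app V)) : Mono f := by
  haveI : ∀ V, Mono (f.mapPresheaf.app V) := fun V => ConcreteCategory.mono_of_injective _ (h V.unop)
  haveI : Mono f.mapPresheaf := NatTrans.mono_of_mono_app _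
  exact (Scheme.Modules.toPresheaf X).mono_of_mono_map this

include hU in
/-- Every point lies in some member of the cover. [folklore] -/
lemma exists_mem (x : X) : ∃ a, x ∈ U a := by
  have hx : x ∈ (iSup U : X.Opens) := by rw [hU]; trivial
  exact Opens.mem_iSup.mp hx

include hU in
/-- **The augmentation is a monomorphism** for a cover (a section vanishing on every `V ⊓ U_i`
vanishes). [cite: Hartshorne1977, III Lemma 4.2] -/
theorem mono_augment : Mono (augment U M) := by
  refine mono_of_injective_app _ fun V => ?_
  intro x y hxy
  apply TopCat.Sheaf.eq_of_locally_eq' (abSheaf M) (fun a : ι => V ⊓ face U (fun _ : Fin 1 => a)) V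
    (fun a => homOfLE inf_le_left)
  · intro z hz
    obtain ⟨a, ha⟩ := exists_mem U hU z
    exact Opens.mem_iSup.mpr ⟨a, ⟨hz, le_face_zero U (fun _ => a) ha⟩⟩
  · intro a
    exact congrFun (congrArg (fun t : Sections U 0 M V => t) hxy) (fun _ => a)

include hU in
/-- Local exactness at the augmentation: a `0`-cochain killed by `d` is locally an augmentation.
[cite: Hartshorne1977, III Lemma 4.2] -/
theorem augment_locally_exact (V : X.Opens) (s : Γ(obj U 0 M, V)) (hs : (d U M 0).app V s = 0)
    (x : X) (hx : x ∈ V) :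
    ∃ (W : X.Opens) (i : W ⟶ V), x ∈ W ∧
      ∃ t : Γ(M, W), (augment U M).app W t = (obj U 0 M).presheaf.map i.op s := by
  obtain ⟨a, ha⟩ := exists_mem U hU x
  refine ⟨V ⊓ U a, homOfLE inf_le_left, ⟨hx, ha⟩, ?_⟩
  have hs' : dSections U M 0 (V ⊓ U a) (res (obj U 0 M) inf_le_left s) = 0 := by
    rw [← d_app_eq_dSections, app_res, hs]
    exact map_zero _
  obtain ⟨y, hy⟩ := eq_augment_of_d_eq_zero (inf_le_right : V ⊓ U a ≤ U a) _ hs'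
  exact ⟨y, funext hy⟩

include hU in
/-- Local exactness in positive degrees: an `(n+1)`-cochain killed by `d` is locally a coboundary
(`s = d(hs) + h(ds) = d(hs)` over `V ⊓ U_a`). [cite: Hartshorne1977, III Lemma 4.2] -/
theorem d_locally_exact (n : ℕ) (V : X.Opens) (s : Γ(obj U (n + 1) M, V))
    (hs : (d U M (n + 1)).app V s = 0) (x : X) (hx : x ∈ V) :
    ∃ (W : X.Opens) (i : W ⟶ V), x ∈ W ∧
      ∃ t : Γ(obj U n M, W), (d U M n).app W t = (obj U (n + 1) M).presheaf.map i.op s := by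
  obtain ⟨a, ha⟩ := exists_mem U hU x
  refine ⟨V ⊓ U a, homOfLE inf_le_left, ⟨hx, ha⟩, ?_⟩
  have hV : V ⊓ U a ≤ U a := inf_le_right
  have hs' : dSections U M (n + 1) (V ⊓ U a) (res (obj U (n + 1) M) inf_le_left s) = 0 := by
    rw [← d_app_eq_dSections, app_res, hs]
    exact map_zero _
  refine ⟨homotopy hV n (res (obj U (n + 1) M) inf_le_left s), ?_⟩
  have h := d_homotopy_add_homotopy_d hV n (res (obj U (n + 1) M) inf_le_left s)
  rw [hs', homotopy_zero, add_zero] at h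
  rw [d_app_eq_dSections]
  exact h

/-- The augmentation short complex `M → Č⁰ → Č¹` built on `Cech.d`. [folklore] -/
abbrev augmentShortComplex : ShortComplex X.Modules :=
  ShortComplex.mk (augment U M) (d U M 0) (augment_d U M)

/-- The pieces `Čⁿ → Čⁿ⁺¹ → Čⁿ⁺²` built on `Cech.d`. [folklore] -/
abbrev dShortComplex (n : ℕ) : ShortComplex X.Modules :=
  ShortComplex.mk (d U M n) (d U M (n + 1)) (d_comp_d U M n)

include hU in
/-- **Exactness at the augmentation**: `M → Č⁰ → Č¹` is exact for a cover.
[cite: Hartshorne1977, III Lemma 4.2] -/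
theorem exact_augmentShortComplex : (augmentShortComplex U M).Exact :=
  exact_of_locally_exact _ fun V s hs x hx => augment_locally_exact U M hU V s hs x hx

include hU in
/-- **Exactness in positive degrees**: `Čⁿ → Čⁿ⁺¹ → Čⁿ⁺²` is exact for a cover.
[cite: Hartshorne1977, III Lemma 4.2] -/
theorem exact_dShortComplex (n : ℕ) : (dShortComplex U M n).Exact :=
  exact_of_locally_exact _ fun V s hs x hx => d_locally_exact U M hU n V s hs x hx

/-- `ε ≫ d = 0` for the differential of the complex. [folklore] -/
lemma augment_complex_d : augment U M ≫ (complex U M).d 0 1 = 0 := by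
  rw [complex_d]; exact augment_d U M

include hU in
/-- Exactness at the augmentation, for the differential of `Cech.complex`.
[cite: Hartshorne1977, III Lemma 4.2] -/
theorem exact_augment :
    (ShortComplex.mk (augment U M) ((complex U M).d 0 1) (augment_complex_d U M)).Exact := by
  refine (ShortComplex.exact_iff_of_iso ?_).mp (exact_augmentShortComplex U M hU)
  exact ShortComplex.isoMk (Iso.refl _) (Iso.refl _) (Iso.refl _)
    (by exact (Category.id_comp _).trans (Category.comp_id _).symm)
    (by exact (Category.id_comp _).trans ((complex_d U M 0).trans (Category.comp_id _).symm))

include hU in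
/-- Exactness of `Cech.complex` in positive degrees. [cite: Hartshorne1977, III Lemma 4.2] -/
theorem exactAt_succ (n : ℕ) : (complex U M).ExactAt (n + 1) := by
  rw [(complex U M).exactAt_iff' n (n + 1) (n + 2) (CochainComplex.prev_nat_succ n)
    (CochainComplex.next ℕ (n + 1))]
  refine (ShortComplex.exact_iff_of_iso ?_).mp (exact_dShortComplex U M hU n)
  exact ShortComplex.isoMk (Iso.refl _) (Iso.refl _) (Iso.refl _)
    (by change 𝟙 _ ≫ (complex U M).d n (n + 1) = d U M n ≫ 𝟙 _
        rw [complex_d]; exact (Category.id_comp _).trans (Category.comp_id _).symm)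
    (by change 𝟙 _ ≫ (complex U M).d (n + 1) (n + 2) = d U M (n + 1) ≫ 𝟙 _
        rw [complex_d]; exact (Category.id_comp _).trans (Category.comp_id _).symm)

/-- **The Čech resolution**: for an open cover `𝓤` of `X`, the augmented sheaf Čech complex
`0 → M → Č⁰(𝓤, M) → Č¹(𝓤, M) → ⋯` is exact (an `ExactAugmentation`).
[cite: Hartshorne1977, III Lemma 4.2] -/
def exactAugmentation : Literature.Algebra.Homology.ExactAugmentation (complex U M) M where
  ε := augment U M
  ε_d := augment_complex_d U M
  mono_ε := mono_augment U M hU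
  exact₀ := exact_augment U M hU
  exactAt_succ := exactAt_succ U M hU

/-- The augmentation of the Čech resolution is `Cech.augment`. [folklore] -/
@[simp] lemma exactAugmentation_ε : (exactAugmentation U M hU).ε = augment U M := rfl

end Cech

end Literature.AlgebraicGeometry.Modules

end
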